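import Summits.AtomisticToContinuum.HydrodynamicLimit.Theorems.KinematicRungDefs
import Summits.AtomisticToContinuum.HydrodynamicLimit.Theorems.KinematicRungKinematicMeanClosureOnPath
import Summits.AtomisticToContinuum.HydrodynamicLimit.Theorems.RelayRaceLocalityRestartPrincipleStubMeanClosure
import HarnessLib

/-!
# Route `KinematicRung` — the mean-closure ladder pinned at both ends

With the graded family `MeanClosureRung k` of `Theorems/KinematicRungDefs.lean` (k mean channels
assumed on `[0,t]`), this file records the two pins of the forward discipline for the route's rung
`KinematicMeanClosure = MeanClosureRung 2` (stmt-AtomisticToContinuum-20153):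

* the FLOOR end (F3 witness direction): `meanClosureRung_three : MeanClosureRung 3`, from the proved
  floor `ResponseRigidity.MeanClosure`
  (`Theorems.RestartPrinciple.AgeDuhamelForgetting.meanClosure_holds`, stmt-11929), hence every rung
  `k ≥ 3` holds (`meanClosureRung_of_three_le`);
* the STATEMENT end (F4 on-path direction): the Statement is `MeanClosureRung 0` and the ladder is
  monotone, so `HydrodynamicLimit → MeanClosureRung k` for all `k`; at `k = 2` this recovers the
  landed on-path lemma `KinematicMeanClosure_of_HydrodynamicLimit` through `meanClosureRung_two_iff`
  (`kinematicMeanClosure_of_hydrodynamicLimit_via_ladder`: the same implication obtained by the dial).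

So the open content of the route's rung is exactly the step `k = 3 → k = 2` DOWN the ladder (drop the
energy-mean channel), the one move the route's thesis isolates. Pure logic; no analysis.

prover-fwd2-land-3-0 (on-path lander), 2026-08-18.
-/

namespace Summit.AtomisticToContinuum.HydrodynamicLimit.Theorems

open Summit.AtomisticToContinuum.HydrodynamicLimit.Theses

/-- **Floor pin.** The rung at `k = 3` holds outright: the proved floor `ResponseRigidity.MeanClosure`
(`meanClosure_holds`) specialises to it (`meanClosureRung_three_of_meanClosure`). -/
theorem meanClosureRung_three : MeanClosureRung 3 :=
  meanClosureRung_three_of_meanClosure RestartPrinciple.AgeDuhamelForgetting.meanClosure_holds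

/-- Every rung above the floor holds: `3 ≤ k → MeanClosureRung k` (floor pin + dial monotonicity). -/
theorem meanClosureRung_of_three_le {k : ℕ} (hk : 3 ≤ k) : MeanClosureRung k :=
  meanClosureRung_three.mono hk

/-- **Statement pin, read at the route's rung.** The on-path implication
`HydrodynamicLimit → KinematicMeanClosure` obtained by the dial: Statement `= MeanClosureRung 0`
(`meanClosureRung_zero_iff`), monotone up to `k = 2` (`MeanClosureRung.mono`), `= KinematicMeanClosure`
(`meanClosureRung_two_iff`). Same statement as the directly landed
`KinematicMeanClosure_of_HydrodynamicLimit`. -/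
theorem kinematicMeanClosure_of_hydrodynamicLimit_via_ladder (h : _root_.HydrodynamicLimit) :
    KinematicRung.KinematicMeanClosure :=
  meanClosureRung_two_iff.1 (meanClosureRung_of_hydrodynamicLimit 2 h)

end Summit.AtomisticToContinuum.HydrodynamicLimit.Theorems
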